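import Summits.BirchSwinnertonDyer.BirchSwinnertonDyer.Theorems.GenusKolyvaginAtTwoShaCardDvdPowAtTwoRTwoPowerImageOverK
import Summits.BirchSwinnertonDyer.BirchSwinnertonDyer.Theorems.GenusKolyvaginAtTwoShaCardDvdPowAtTwoREntanglement
import Literature.NumberTheory.EllipticCurves.DivisionTowerH1OrderTwoSurjective
import Literature.NumberTheory.EllipticCurves.HeegnerPointsKolyvaginConjugation
import HarnessLib

/-!
# Route `GenusKolyvaginAtTwo`, LINE 13, crux U `ShaCardDvdPowAtTwoR` (stmt-BirchSwinnertonDyer-28029):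
# the repaired habitat condition (H2′) is UNCONDITIONAL on the genus habitat — both displayed inputs
# `hNfix`, `hN2` of `sel_visible_two_of_kernel_inputs` discharged

Seat `bsd-line-gk2-p3` g15 (cell `bsd-f1-sign2`), `--supports stmt-BirchSwinnertonDyer-28029` (helper; closes
nothing). THEOREMS ONLY (no definition, no named fact, no `sorry`); BSD is not proved by any of this.

The (H2′) condition of the `ℚ`-pair frame at `2` (this lineage, g13/g14:
`VisiblePairAtTwo.sel_visible_two_of_kernel_inputs`, file `…ShaCardDvdPowAtTwoREntanglement`) — a tie
`rK₁ s₁ + rK₂ s₂ = 0` in `Hom(Γ_{K(E[2^M])}, E[2^M])` between a class of `E` and a class of the twin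
`E^{(d_K)}` forces `2s₁ = 0 ∧ 2s₂ = 0` — was proved MODULO two inputs on the inflation kernel
`N = {y ∈ H¹(K, E_K[2^M]) : [y, ρ] = 0 ∀ ρ ∈ Γ_{K(E[2^M])}}`: (`hN2`) `2N = 0` and (`hNfix`) `σ₀` acts
trivially on `N`. Both are now theorems on the habitat of the GK2 cruxes (`K` imaginary quadratic, `d_K`
odd, `d_K·(−|Δ|) ∉ ℚ²`, `d_K·(−2|Δ|) ∉ ℚ²`, `ρ̄_{E,2ⁿ}` onto over `ℚ` for all `n > 0`):

* `hN2`: Lawson–Wuthrich at the even prime OVER `K` (LEAD gk2-p1 g11,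
  `LawsonWuthrich2016.two_zsmul_eq_zero_of_forall_h1Eval_eq_zero_of_hasSurjectiveModNGaloisRep`), whose
  hypothesis «`ρ̄_{E_K,2^M}` onto OVER `K`» is this seat's `ℚ → K` transfer
  (`TwoPowerImageOverK.hasSurjectiveModNGaloisRep_two_pow_baseChange_of_habitat`);
* `hNfix`: `N` has at most one non-zero element (LEAD g11,
  `LawsonWuthrich2016.eq_zero_or_eq_zero_or_eq_of_forall_h1Eval_eq_zero`, again over `K` through the transfer),
  `N` is `σ₀`-stable (evaluation formula `[σ₀ y, ρ] = τ[y, τ⁻¹ρτ]` for an involutive lift `τ` of `σ₀`, tree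
  `IsLiftOfAut.h1Eval_conjAct`, `RatClosure.isLiftOfAut_absGaloisTransport_of_isImaginaryQuadratic`), and `σ₀`
  is injective on `H¹` — so it fixes `N` pointwise.

Main theorem: **`sel_visible_two_of_habitat`** — (H2′) with the crux binders as its only hypotheses
(`M ≥ 1`). BSD is not proved by any of this.

References: [LawsonWuthrich2016] §7.1, §8; [McCallumLMS1991] p. 299; [GrossLMS1991] §5 (5.1), §9;
[Serre1972] §5.3.
-/

set_option autoImplicit false
set_option linter.dupNamespace false

noncomputable section

open scoped Classical

namespace Summit.BirchSwinnertonDyer.BirchSwinnertonDyer.Theorems.GenusExact.VisiblePairAtTwo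

open WeierstrassCurve NumberField Field
open Literature.NumberTheory.EllipticCurves Literature.NumberTheory.GaloisRepresentations
open Summit.BirchSwinnertonDyer.BirchSwinnertonDyer.Theorems.GenusExact.EigenClassesFinite

section Habitat

variable (W : WeierstrassCurve ℚ) [W.IsElliptic] (K : Type) [Field K] [NumberField K] (M : ℕ)
  (hK : IsImaginaryQuadratic K) {θ : K} (hθ : θ ∉ Set.range (algebraMap ℚ K))
  (hθsq : θ ^ 2 = algebraMap ℚ K ((NumberField.discr K : ℤ) : ℚ))
  (hodd : Odd (NumberField.discr K)) (hsq1 : ¬ IsSquare ((NumberField.discr K : ℚ) * -|W.Δ|))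
  (hsq2 : ¬ IsSquare ((NumberField.discr K : ℚ) * (-(2 * |W.Δ|))))
  (hρ : ∀ n : ℕ, 0 < n → W.HasSurjectiveModNGaloisRep ((2 : ℤ) ^ n))

include hK hodd hsq1 hsq2 hρ in
/-- **`ρ̄_{E_K, 2^M}` onto over `K` on the habitat**, at the level `lvl M = 2^M` of the `ℚ`-pair frame
(this seat's `TwoPowerImageOverK.hasSurjectiveModNGaloisRep_two_pow_baseChange_of_habitat`). [cite: Serre1972, §5.3] -/
theorem hasSurjectiveModNGaloisRep_baseChange_lvl :
    (W.baseChange K).HasSurjectiveModNGaloisRep (lvl M) := by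
  have h := TwoPowerImageOverK.hasSurjectiveModNGaloisRep_two_pow_baseChange_of_habitat W K hK hodd hsq1
    hsq2 hρ M
  have hcast : ((2 : ℤ) ^ M) = lvl M := by simp [lvl]
  rwa [hcast] at h

include hK hodd hsq1 hsq2 hρ in
/-- **`hN2` on the habitat: `2 · N = 0`** — every class of `H¹(K, E_K[2^M])` all of whose evaluations on
`Γ_{K(E[2^M])}` vanish is killed by `2` (Lawson–Wuthrich at `2` over `K`, LEAD gk2-p1 g11, fed with the
`ℚ → K` transfer). [cite: LawsonWuthrich2016, §7.1 and Lemma 3] -/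
theorem two_zsmul_eq_zero_of_forall_h1Eval_eq_zero_habitat (y : galH1Torsion (W.baseChange K) (lvl M))
    (hy : ∀ ρ : torsionFixing (W.baseChange K) (lvl M), h1Eval (W.baseChange K) (lvl M) y ρ = 0) :
    (2 : ℤ) • y = 0 := by
  haveI : (W.baseChange K).IsElliptic := by rw [baseChange]; infer_instance
  have hn : (lvl M : ℤ) ≠ 0 := by simp [lvl]
  exact LawsonWuthrich2016.two_zsmul_eq_zero_of_forall_h1Eval_eq_zero_of_hasSurjectiveModNGaloisRep
    (W := W.baseChange K) hn (hasSurjectiveModNGaloisRep_baseChange_lvl W K M hK hodd hsq1 hsq2 hρ)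
    (fun ρ hρ' ↦ hy ⟨ρ, hρ'⟩)

include hodd hsq1 hsq2 hρ in
/-- **`hNfix` on the habitat: `σ₀` fixes `N` pointwise** (`M ≥ 1`). `N` has at most one non-zero element
(Lawson–Wuthrich order bound over `K`, LEAD g11), is stable under `σ₀` (evaluation formula for an involutive
lift of `σ₀`), and `σ₀` is injective on `H¹(K, E_K[2^M])`. [cite: LawsonWuthrich2016, §7.1]
[cite: GrossLMS1991, §9 (the pairing [s, ρ] and its Galois equivariance)] -/
theorem conjAct_eq_self_of_forall_h1Eval_eq_zero_habitat (hM : 1 ≤ M)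
    (y : galH1Torsion (W.baseChange K) (lvl M))
    (hy : ∀ ρ : torsionFixing (W.baseChange K) (lvl M), h1Eval (W.baseChange K) (lvl M) y ρ = 0) :
    conjAct W (sigmaQ K hK.1 hθ hθsq) (lvl M) y = y := by
  haveI : (W.baseChange K).IsElliptic := by rw [baseChange]; infer_instance
  -- an involutive lift of `σ₀` to `K̄` (complex conjugation transported)
  obtain ⟨c₀, hc₀⟩ := exists_isComplexConjugation (Rat.castHom ℝ)
  have ht : IsLiftOfAut (sigmaQ K hK.1 hθ hθsq) (absGaloisTransport (K := ℚ) (L := K) c₀).toRingEquiv :=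
    RatClosure.isLiftOfAut_absGaloisTransport_of_isImaginaryQuadratic hK (sigmaQ_ne_one K hK.1 hθ hθsq) hc₀
  have hinv : ∀ x, (absGaloisTransport (K := ℚ) (L := K) c₀).toRingEquiv
      ((absGaloisTransport (K := ℚ) (L := K) c₀).toRingEquiv x) = x := fun x ↦
    RatClosure.absGaloisTransport_absGaloisTransport_of_sq_eq_one hc₀.sq_eq_one x
  -- `σ₀ y` has vanishing evaluations too
  have hy' : ∀ ρ ∈ torsionFixing (W.baseChange K) (lvl M),
      h1Eval (W.baseChange K) (lvl M) (conjAct W (sigmaQ K hK.1 hθ hθsq) (lvl M) y) ρ = 0 := by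
    intro ρ hρ'
    rw [ht.h1Eval_conjAct W (lvl M) y hρ', hy ⟨_, ht.conjGalCMH_mem_torsionFixing W hinv (lvl M) hρ'⟩,
      map_zero]
  -- at most one non-zero such class
  obtain ⟨j, rfl⟩ : ∃ j, M = j + 1 := ⟨M - 1, by omega⟩
  have h2K : (2 : K) ≠ 0 := two_ne_zero
  rcases LawsonWuthrich2016.eq_zero_or_eq_zero_or_eq_of_forall_h1Eval_eq_zero (W.baseChange K) j h2K
      (hasSurjectiveModNGaloisRep_baseChange_lvl W K (j + 1) hK hodd hsq1 hsq2 hρ)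
      (fun ρ hρ' ↦ hy ⟨ρ, hρ'⟩) hy' with h0 | h0 | h0
  · rw [h0, map_zero]
  · -- `σ₀` is an involution of `H¹`, hence injective
    have hσσ : sigmaQ K hK.1 hθ hθsq * sigmaQ K hK.1 hθ hθsq = 1 :=
      AlgEquiv.ext fun x ↦ Literature.NumberTheory.QuadraticFields.Quadratic.conj_conj hK.1 hθ hθsq x
    have hy0 : y = 0 := by
      rw [← conjAct_conjAct_of_mul_self W hσσ (lvl (j + 1)) y, h0, map_zero]
    rw [hy0, map_zero]
  · exact h0.symm

include hK hodd hsq1 hsq2 hρ in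
/-- **(H2′) ON THE HABITAT, UNCONDITIONAL** (`M ≥ 1`): for `E/ℚ` and `K` imaginary quadratic with `d_K` odd,
`d_K·(−|Δ|) ∉ ℚ²`, `d_K·(−2|Δ|) ∉ ℚ²`, `ρ̄_{E,2ⁿ}` onto for all `n > 0` (the binders of 22137 / Q3R 27720 /
U 28029 / L 28030), every pair of SELMER classes `s₁ ∈ Sel^{(2^M)}(E/ℚ)`, `s₂ ∈ Sel^{(2^M)}(E^{(d_K)}/ℚ)` tied in
`Hom(Γ_{K(E[2^M])}, E[2^M])` (`rK₁ s₁ + rK₂ s₂ = 0`) is a pair of `2`-torsion classes. This is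
`sel_visible_two_of_kernel_inputs` with BOTH displayed inputs discharged (`hNfix`:
`conjAct_eq_self_of_forall_h1Eval_eq_zero_habitat`; `hN2`: `two_zsmul_eq_zero_of_forall_h1Eval_eq_zero_habitat`).
[cite: McCallumLMS1991, p. 299] [cite: LawsonWuthrich2016, §7.1 and §8] -/
theorem sel_visible_two_of_habitat (hM : 1 ≤ M) :
    ∀ s₁ ∈ selmerGroup W (lvl M), ∀ s₂ ∈ selmerGroup (twin W K) (lvl M),
      rK₁ W K M s₁ + rK₂ W M hθ hθsq s₂ = 0 → (2 : ℤ) • s₁ = 0 ∧ (2 : ℤ) • s₂ = 0 := by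
  have hs : W.HasSurjectiveModNGaloisRep 2 := by simpa using hρ 1 one_pos
  exact sel_visible_two_of_kernel_inputs W K M hK.1 hθ hθsq hs
    (fun y hy ↦ conjAct_eq_self_of_forall_h1Eval_eq_zero_habitat W K M hK hθ hθsq hodd hsq1 hsq2 hρ hM y hy)
    (fun y hy ↦ two_zsmul_eq_zero_of_forall_h1Eval_eq_zero_habitat W K M hK hodd hsq1 hsq2 hρ y hy)

end Habitat

end Summit.BirchSwinnertonDyer.BirchSwinnertonDyer.Theorems.GenusExact.VisiblePairAtTwo

end
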